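import Mathlib
import Summits.QuantumFields.YangMills.Theses.CoarseStiffnessTail
import Summits.QuantumFields.YangMills.Theorems.UnitScaleTiltHistoryTailChessboardT3
import Summits.QuantumFields.YangMills.Theorems.SmallFieldWideningLargeFieldMassRefinementTailSubGaussianRung
import Literature.MathematicalPhysics.QuantumFieldTheory.Balaban1983to89.T3AveragedTailProfile
import Literature.MathematicalPhysics.QuantumFieldTheory.Balaban1983to89.T3FinestHeightTail

/-!
# Route `CoarseStiffnessTail` — THE GLUE `HistoryTailOfStiffness` (stmt-QuantumFields-25302), PROVED:
# capped coarse stiffness ⇒ the body of `UnitScaleTilt.HistoryTailL`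

Prover seat `ym-line-cst-p1` (g0), route `CoarseStiffnessTail` (ideator `ym-r3-idea-2` g0, LINE 1, lens «nearmiss»; rung R3 =
the RECORD leaf `T3YM3TorusStatement.YM3TorusSU2`, NOT the Clay statement).  This file closes the route's SUPPORT item
`HistoryTailOfStiffness` (provable-now glue): the crux `CappedCoarseStiffnessL` (stmt-QuantumFields-25301, OPEN, XL — one capped,
windowed-quadratic tilted partition function per RG level with free energy `O(1)` per level-`j` plaquette) implies, for every block
size `L` and every threshold floor `(b₁, p₁)`, the body of the parent crux `UnitScaleTilt.HistoryTailL` (stmt-QuantumFields-19936) at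
the profile `b₀ = max b₁ 1`, `p₀ = max p₁ 3`, for every volume exponent `m > 0`, with the crux's own coupling threshold `γ₁`.

THE ARGUMENT (exactly the item's informal text).
* §1 bookkeeping: `#Plaq_j ≤ 9·(sites per direction)³` (crude plane-label count), hence with the chessboard family `S` of
  `HistoryTailChessboardT3.chessboardRP_T3` at separation `ρ = 1` (`(sites per direction)³ ≤ |S|·8(5L)³`): `#Plaq_j ≤ 9000·L³·|S|`.
* §2 THE PER-PLAQUETTE SCHEMA from the capped stiffness (`perPlaquette_of_cappedStiffness`): fix `K`, `j ≤ K`, a level-`j` plaquette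
  `p`, `θ = θBal(K−j) > 0`, `β = β_{K−j} = (γL^{−(K−j)})⁻¹`.  Chessboard: `Gibbs_K{θ ≤ |Ū^j(∂p) − 1|} ≤ Gibbs_K{∀ q ∈ S, θ ≤ |Ū^j(∂q) − 1|}^{1/|S|}`.
  On the joint event every `q ∈ S` contributes `min(dist1², θ²) = θ²` to the capped stiffness `X = Σ_a min(|Ū^j(∂a) − 1|², θ²)` and the
  other summands are `≥ 0`, so the joint event lies in `{|S|·θ² ≤ X}`; exponential Chebyshev (`measure_ge_le_exp_mul_mgf` at `t = c₀β`,
  the integrand is bounded by `e^{c₀β·#Plaq_j·θ²}` hence integrable) and the crux give `≤ e^{−c₀β|S|θ²}·e^{C₀#Plaq_j}`; the `1/|S|`-th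
  power is `exp(−c₀βθ² + C₀#Plaq_j/|S|) ≤ e^{9000L³|C₀|}·e^{−c₀·p(g_{K−j})²}` by §1 and `βθ² = p(g_{K−j})²`
  (`T3FinestHeightTail.beta_mul_θBal_sq`) — the per-plaquette schema with `C = e^{9000L³|C₀|}`, `A = 0`, `c = c₀`.
* §3 the item BY NAME (`historyTailOfStiffness_proof`): `T3AveragedTailProfile.historyTailAt_of_perPlaquette` (`0 < γ ≤ γ₁ ≤ 1`,
  `0 < b₀`, `1 ≤ p₀`, `0 < m`).

HONEST SCOPE.  Pure measure theory + the landed chessboard; NOTHING of Bałaban's estimates is proved here: the crux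
`CappedCoarseStiffnessL` (the located, unprinted large-field content — [Balaban1985UV3] (5) p.256 read at two couplings, (70)–(71)
p.273) stays OPEN, as do the parent route's residual cruxes 19200/20520.  No rung, no leaf, no summit: `YM3TorusSU2` (R3 record) is
NOT proved, the Yang–Mills mass gap is NOT touched.

References: J. Fröhlich, R. Israel, E. Lieb, B. Simon, CMP **62** (1978) 1–34 [FrohlichIsraelLiebSimon1978] (Thm 4.1, chessboard);
T. Bałaban, CMP **102** (1985) 255–275 [Balaban1985UV3] ((7) p.257, (71) p.273).
-/

noncomputable section

namespace Summit.QuantumFields.YangMills.Theorems.CoarseStiffnessTailHistoryTailOfStiffness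

open MeasureTheory ProbabilityTheory Finset
open Literature.MathematicalPhysics.QuantumFieldTheory
open Literature.MathematicalPhysics.QuantumFieldTheory.Balaban1983to89
open Literature.MathematicalPhysics.QuantumFieldTheory.Balaban1983to89.T3ContinuumYM3Torus
open Literature.MathematicalPhysics.QuantumFieldTheory.Balaban1983to89.T3UnitScaleTilt
open Literature.MathematicalPhysics.QuantumFieldTheory.Balaban1983to89.T3UnitLawDensityEML
open Literature.MathematicalPhysics.QuantumFieldTheory.Balaban1983to89.T3AveragedTailProfile
open Literature.MathematicalPhysics.QuantumFieldTheory.Balaban1983to89.T3FinestHeightTail (beta_mul_θBal_sq)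
open Literature.MathematicalPhysics.QuantumFieldTheory.Balaban1983to89.T3MinimiserStabilityReduction (θBal_pos)
open Summit.QuantumFields.YangMills.Theorems.HistoryTailChessboardT3 (chessboardRP_T3)
open Summit.QuantumFields.YangMills.Theorems.LargeFieldMassRefinementTailSubGaussianRung (measurable_dist1_iter)

/-! ## §1 Bookkeeping: plaquette counts -/

section Counting

variable (F : T3Family)

/-- `#plaquettes of T^{(j)} ≤ 9·(sites per direction)³` (crude: `d² = 9` plane labels per site; same count as the tree's private
`T3AveragedTailProfile.card_plaq_le`). [cite: Balaban1985UV3, (1)-(3) p.256] -/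
theorem card_plaq_le_nine_mul (K j : ℕ) :
    (Fintype.card (Plaq (F.P K) j) : ℝ) ≤ 9 * ((F.P K).sitesPerDir j : ℝ) ^ 3 := by
  have h1 : Fintype.card (Plaq (F.P K) j) = Fintype.card (Plaquette 3 ((F.P K).sitesPerDir j)) :=
    Fintype.card_congr (plaqEquiv (P := F.P K) j)
  have h2 : Fintype.card (Plaquette 3 ((F.P K).sitesPerDir j)) ≤ ((F.P K).sitesPerDir j) ^ 3 * 3 ^ 2 := by
    rw [Fintype.card_prod, Fintype.card_fun, ZMod.card, Fintype.card_fin]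
    gcongr
    calc Fintype.card {p : Fin 3 × Fin 3 // p.1 < p.2} ≤ Fintype.card (Fin 3 × Fin 3) := Fintype.card_subtype_le _
      _ = 3 ^ 2 := by rw [Fintype.card_prod, Fintype.card_fin]; norm_num
  rw [h1]
  calc (Fintype.card (Plaquette 3 ((F.P K).sitesPerDir j)) : ℝ) ≤ (((F.P K).sitesPerDir j) ^ 3 * 3 ^ 2 : ℕ) := by
        exact_mod_cast h2
    _ = 9 * ((F.P K).sitesPerDir j : ℝ) ^ 3 := by push_cast; ring

/-- With a chessboard family `S` at separation `ρ = 1` (`(sites per direction)³ ≤ |S|·8(L·(1+4))³`): `#Plaq_j ≤ 9000·L³·|S|`.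
[cite: FrohlichIsraelLiebSimon1978, Thm 4.1] -/
theorem card_plaq_le_of_chessboard (K j : ℕ) {S : Finset (Plaq (F.P K) j)}
    (hS : ((F.P K).sitesPerDir j : ℝ) ^ 3 ≤ (S.card : ℝ) * (8 * ((F.L : ℝ) * (1 + 4)) ^ 3)) :
    (Fintype.card (Plaq (F.P K) j) : ℝ) ≤ 9000 * (F.L : ℝ) ^ 3 * (S.card : ℝ) := by
  refine (card_plaq_le_nine_mul F K j).trans ?_
  have : 9 * ((F.P K).sitesPerDir j : ℝ) ^ 3 ≤ 9 * ((S.card : ℝ) * (8 * ((F.L : ℝ) * (1 + 4)) ^ 3)) := by linarith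
  refine this.trans (le_of_eq ?_)
  ring

end Counting

/-! ## §2 The per-plaquette schema from the capped stiffness: chessboard + exponential Chebyshev -/

section PerPlaquette

variable (F : T3Family)

/-- The capped stiffness observable `X_j(U) = Σ_{a ∈ Plaq_j} min(|Ū^j(∂a) − 1|², θ²)` is measurable. [folklore] -/
theorem measurable_capSum (K j : ℕ) (θ : ℝ) :
    Measurable fun U : GaugeField (F.P K) 0 (Matrix.specialUnitaryGroup (Fin 2) ℂ) =>
      ∑ a : Plaq (F.P K) j, min (GaugeGroup.dist1 (GaugeField.plaqHol
        (Averaging.iter (fun i => BlockAveraging.blockAvg (P := F.P K) (j := i) ℰp) j U) a) ^ 2) (θ ^ 2) := by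
  refine Finset.measurable_sum _ fun a _ => ?_
  exact ((measurable_dist1_iter F K j a).pow_const 2).min measurable_const

/-- `0 ≤ X_j(U) ≤ #Plaq_j·θ²`. [folklore] -/
theorem capSum_mem (K j : ℕ) (θ : ℝ) (U : GaugeField (F.P K) 0 (Matrix.specialUnitaryGroup (Fin 2) ℂ)) :
    0 ≤ ∑ a : Plaq (F.P K) j, min (GaugeGroup.dist1 (GaugeField.plaqHol
        (Averaging.iter (fun i => BlockAveraging.blockAvg (P := F.P K) (j := i) ℰp) j U) a) ^ 2) (θ ^ 2) ∧
    ∑ a : Plaq (F.P K) j, min (GaugeGroup.dist1 (GaugeField.plaqHol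
        (Averaging.iter (fun i => BlockAveraging.blockAvg (P := F.P K) (j := i) ℰp) j U) a) ^ 2) (θ ^ 2) ≤
      (Fintype.card (Plaq (F.P K) j) : ℝ) * θ ^ 2 := by
  constructor
  · exact Finset.sum_nonneg fun a _ => le_min (sq_nonneg _) (sq_nonneg _)
  · calc ∑ a : Plaq (F.P K) j, min (GaugeGroup.dist1 (GaugeField.plaqHol
          (Averaging.iter (fun i => BlockAveraging.blockAvg (P := F.P K) (j := i) ℰp) j U) a) ^ 2) (θ ^ 2)
        ≤ ∑ _a : Plaq (F.P K) j, θ ^ 2 := Finset.sum_le_sum fun a _ => min_le_right _ _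
      _ = (Fintype.card (Plaq (F.P K) j) : ℝ) * θ ^ 2 := by rw [Finset.sum_const, Finset.card_univ, nsmul_eq_mul]

/-- On the joint event `{∀ q ∈ S, θ ≤ |Ū^j(∂q) − 1|}` (`θ ≥ 0`) the capped stiffness is at least `|S|·θ²`: each `q ∈ S` contributes
`min(dist1², θ²) = θ²`, the remaining summands are `≥ 0`. [folklore] -/
theorem card_mul_sq_le_capSum (K j : ℕ) {θ : ℝ} (hθ : 0 ≤ θ) (S : Finset (Plaq (F.P K) j))
    (U : GaugeField (F.P K) 0 (Matrix.specialUnitaryGroup (Fin 2) ℂ))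
    (hU : ∀ q ∈ S, θ ≤ GaugeGroup.dist1 (GaugeField.plaqHol
        (Averaging.iter (fun i => BlockAveraging.blockAvg (P := F.P K) (j := i) ℰp) j U) q)) :
    (S.card : ℝ) * θ ^ 2 ≤ ∑ a : Plaq (F.P K) j, min (GaugeGroup.dist1 (GaugeField.plaqHol
        (Averaging.iter (fun i => BlockAveraging.blockAvg (P := F.P K) (j := i) ℰp) j U) a) ^ 2) (θ ^ 2) := by
  calc (S.card : ℝ) * θ ^ 2 = ∑ _q ∈ S, θ ^ 2 := by rw [Finset.sum_const, nsmul_eq_mul]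
    _ ≤ ∑ q ∈ S, min (GaugeGroup.dist1 (GaugeField.plaqHol
        (Averaging.iter (fun i => BlockAveraging.blockAvg (P := F.P K) (j := i) ℰp) j U) q) ^ 2) (θ ^ 2) := by
        refine Finset.sum_le_sum fun q hq => le_min ?_ le_rfl
        exact pow_le_pow_left₀ hθ (hU q hq) 2
    _ ≤ ∑ a : Plaq (F.P K) j, min (GaugeGroup.dist1 (GaugeField.plaqHol
        (Averaging.iter (fun i => BlockAveraging.blockAvg (P := F.P K) (j := i) ℰp) j U) a) ^ 2) (θ ^ 2) :=
        Finset.sum_le_sum_of_subset_of_nonneg (Finset.subset_univ S) fun a _ _ => le_min (sq_nonneg _) (sq_nonneg _)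

/-- **THE PER-PLAQUETTE SCHEMA FROM THE CAPPED STIFFNESS** (one family `F`, one coupling `0 < γ ≤ 1`, `0 < b₀`): if for some
`c₀ > 0`, `C₀` the capped tilted partition functions obey `∫ exp(c₀β_{K−j}X_j) dGibbs_K ≤ exp(C₀#Plaq_j)` for all `j ≤ K`, then every
level-`j` averaged plaquette has the Gibbs tail `Gibbs_K{θ(K−j) ≤ |Ū^j(∂p) − 1|} ≤ e^{9000L³|C₀|}·β_{K−j}^0·exp(−c₀·p(g_{K−j})²)` —
chessboard (`chessboardRP_T3`, `ρ = 1`) + exponential Chebyshev on the joint event + `βθ² = p(g)²`.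
[cite: FrohlichIsraelLiebSimon1978, Thm 4.1] -/
theorem perPlaquette_of_cappedStiffness {γ b₀ p₀ c₀ C₀ : ℝ} (hγ : 0 < γ) (hγ1 : γ ≤ 1) (hb₀ : 0 < b₀) (hc₀ : 0 < c₀)
    (hX : ∀ (K j : ℕ), j ≤ K →
      ∫ U, Real.exp (c₀ * (γ * ((F.L : ℝ)⁻¹) ^ (K - j))⁻¹ *
          ∑ a : Plaq (F.P K) j, min (GaugeGroup.dist1 (GaugeField.plaqHol
            (Averaging.iter (fun i => BlockAveraging.blockAvg (P := F.P K) (j := i) ℰp) j U) a) ^ 2)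
            (θBal F.L γ b₀ p₀ (K - j) ^ 2)) ∂(gibbsK F ℰp γ K) ≤
        Real.exp (C₀ * (Fintype.card (Plaq (F.P K) j) : ℝ))) :
    ∀ (K j : ℕ), 1 ≤ j → j ≤ K → ∀ p : Plaq (F.P K) j,
      (gibbsK F ℰp γ K).real
          {U | θBal F.L γ b₀ p₀ (K - j) ≤
            GaugeGroup.dist1 (GaugeField.plaqHol
              (Averaging.iter (fun i => BlockAveraging.blockAvg (P := F.P K) (j := i) ℰp) j U) p)} ≤
        Real.exp (9000 * (F.L : ℝ) ^ 3 * |C₀|) * (F.scheme ℰp γ).β (K - j) ^ 0 *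
          Real.exp (-(c₀ * B10.pFun b₀ p₀ (Real.sqrt (γ * ((F.L : ℝ)⁻¹) ^ (K - j))) ^ 2)) := by
  intro K j _hj1 hjK p
  haveI := isProbabilityMeasure_gibbsK F ℰp hγ.le K
  have hL1 : 1 < F.L := F.hL.2
  have hL : 1 ≤ F.L := hL1.le
  set θ : ℝ := θBal F.L γ b₀ p₀ (K - j) with hθdef
  have hθ0 : 0 < θ := θBal_pos hL hγ hγ1 hb₀ p₀ (K - j)
  set β : ℝ := (γ * ((F.L : ℝ)⁻¹) ^ (K - j))⁻¹ with hβdef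
  have hβ0 : 0 < β := by
    rw [hβdef]
    have hL0 : (0 : ℝ) < F.L := by exact_mod_cast (zero_lt_one.trans hL1)
    exact inv_pos.mpr (mul_pos hγ (pow_pos (inv_pos.mpr hL0) _))
  have hβeq : (F.scheme ℰp γ).β (K - j) = β := rfl
  -- the capped stiffness observable
  set X : GaugeField (F.P K) 0 (Matrix.specialUnitaryGroup (Fin 2) ℂ) → ℝ := fun U =>
    ∑ a : Plaq (F.P K) j, min (GaugeGroup.dist1 (GaugeField.plaqHol
      (Averaging.iter (fun i => BlockAveraging.blockAvg (P := F.P K) (j := i) ℰp) j U) a) ^ 2) (θ ^ 2) with hXdef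
  -- the chessboard family at separation `ρ = 1`
  obtain ⟨S, hpS, -, hcount, hchess⟩ :=
    chessboardRP_T3 F.L F.hL.1 hL1 F γ rfl hγ hγ1 θ K j hjK 1 le_rfl p
  have hS0 : 0 < S.card := Finset.card_pos.mpr ⟨p, hpS⟩
  have hS0R : (0 : ℝ) < (S.card : ℝ) := by exact_mod_cast hS0
  -- the joint event lies in `{|S|θ² ≤ X}`
  have hsub : {U : GaugeField (F.P K) 0 (Matrix.specialUnitaryGroup (Fin 2) ℂ) |
        ∀ q ∈ S, θ ≤ GaugeGroup.dist1 (GaugeField.plaqHol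
          (Averaging.iter (fun _ => BlockAveraging.blockAvg ℰp) j U) q)} ⊆
      {U | (S.card : ℝ) * θ ^ 2 ≤ X U} := fun U hU =>
    card_mul_sq_le_capSum F K j hθ0.le S U hU
  -- integrability of `exp(t X)`, `t = c₀ β`
  set t : ℝ := c₀ * β with htdef
  have ht0 : 0 ≤ t := (mul_pos hc₀ hβ0).le
  have hint : Integrable (fun U => Real.exp (t * X U)) (gibbsK F ℰp γ K) := by
    have hmeas : Measurable fun U => Real.exp (t * X U) :=
      Real.measurable_exp.comp ((measurable_capSum F K j θ).const_mul t)
    refine (integrable_const (Real.exp (t * ((Fintype.card (Plaq (F.P K) j) : ℝ) * θ ^ 2)))).mono'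
      hmeas.aestronglyMeasurable (ae_of_all _ fun U => ?_)
    rw [Real.norm_eq_abs, abs_of_pos (Real.exp_pos _)]
    exact Real.exp_le_exp.mpr (mul_le_mul_of_nonneg_left (capSum_mem F K j θ U).2 ht0)
  -- exponential Chebyshev on the joint event
  have hmgf : mgf X (gibbsK F ℰp γ K) t ≤ Real.exp (C₀ * (Fintype.card (Plaq (F.P K) j) : ℝ)) := by
    have h := hX K j hjK
    simp only [mgf]
    convert h using 4
  have hjoint : (gibbsK F ℰp γ K).real {U | ∀ q ∈ S, θ ≤ GaugeGroup.dist1 (GaugeField.plaqHol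
        (Averaging.iter (fun _ => BlockAveraging.blockAvg ℰp) j U) q)} ≤
      Real.exp (-t * ((S.card : ℝ) * θ ^ 2)) * Real.exp (C₀ * (Fintype.card (Plaq (F.P K) j) : ℝ)) := by
    refine (measureReal_mono hsub).trans ?_
    refine (measure_ge_le_exp_mul_mgf ((S.card : ℝ) * θ ^ 2) ht0 hint).trans ?_
    exact mul_le_mul_of_nonneg_left hmgf (Real.exp_pos _).le
  -- take the `1/|S|`-th power
  have hbase0 : 0 ≤ (gibbsK F ℰp γ K).real {U | ∀ q ∈ S, θ ≤ GaugeGroup.dist1 (GaugeField.plaqHol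
        (Averaging.iter (fun _ => BlockAveraging.blockAvg ℰp) j U) q)} := measureReal_nonneg
  have hexpS : 0 ≤ (1 : ℝ) / (S.card : ℝ) := by positivity
  have hpow := Real.rpow_le_rpow hbase0 hjoint hexpS
  have hrhs : (Real.exp (-t * ((S.card : ℝ) * θ ^ 2)) * Real.exp (C₀ * (Fintype.card (Plaq (F.P K) j) : ℝ))) ^
        ((1 : ℝ) / (S.card : ℝ)) =
      Real.exp (-(t * θ ^ 2) + C₀ * (Fintype.card (Plaq (F.P K) j) : ℝ) / (S.card : ℝ)) := by
    rw [← Real.exp_add, ← Real.exp_mul]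
    congr 1
    field_simp
  rw [hrhs] at hpow
  refine (hchess.trans hpow).trans ?_
  -- the constants: `C₀ #Plaq_j / |S| ≤ 9000 L³ |C₀|` and `t θ² = c₀ p(g)²`
  have hcard : (Fintype.card (Plaq (F.P K) j) : ℝ) ≤ 9000 * (F.L : ℝ) ^ 3 * (S.card : ℝ) :=
    card_plaq_le_of_chessboard F K j hcount
  have hC : C₀ * (Fintype.card (Plaq (F.P K) j) : ℝ) / (S.card : ℝ) ≤ 9000 * (F.L : ℝ) ^ 3 * |C₀| := by
    rw [div_le_iff₀ hS0R]
    have h1 : C₀ * (Fintype.card (Plaq (F.P K) j) : ℝ) ≤ |C₀| * (Fintype.card (Plaq (F.P K) j) : ℝ) :=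
      mul_le_mul_of_nonneg_right (le_abs_self C₀) (Nat.cast_nonneg _)
    have h2 : |C₀| * (Fintype.card (Plaq (F.P K) j) : ℝ) ≤ |C₀| * (9000 * (F.L : ℝ) ^ 3 * (S.card : ℝ)) :=
      mul_le_mul_of_nonneg_left hcard (abs_nonneg C₀)
    nlinarith
  have htθ : t * θ ^ 2 = c₀ * B10.pFun b₀ p₀ (Real.sqrt (γ * ((F.L : ℝ)⁻¹) ^ (K - j))) ^ 2 := by
    rw [htdef, mul_assoc, ← hβeq, hθdef, beta_mul_θBal_sq F hγ b₀ p₀ (K - j)]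
  rw [pow_zero, mul_one, ← Real.exp_add, htθ]
  exact Real.exp_le_exp.mpr (by linarith)

end PerPlaquette

/-! ## §3 The item BY NAME -/

/-- **THE GLUE `HistoryTailOfStiffness` (stmt-QuantumFields-25302), PROVED**: `CappedCoarseStiffnessL →` for every `L`, `b₁`, `p₁`
the body of `UnitScaleTilt.HistoryTailL` at `b₀ = max b₁ 1`, `p₀ = max p₁ 3` with the crux's threshold `γ₁ ≤ 1`, for every `m > 0` —
`perPlaquette_of_cappedStiffness` fed to the tree's bookkeeping `T3AveragedTailProfile.historyTailAt_of_perPlaquette` (union bound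
over heights and plaquettes, Gaussian-in-`p(g)` beats the polynomial plaquette count).  The crux itself stays OPEN; no rung or summit
is proved. [cite: Balaban1985UV3, (7) p.257 and (71) p.273] -/
theorem historyTailOfStiffness_proof : Summit.QuantumFields.YangMills.Theses.CoarseStiffnessTail.HistoryTailOfStiffness := by
  unfold Summit.QuantumFields.YangMills.Theses.CoarseStiffnessTail.HistoryTailOfStiffness
  intro hS L b₁ p₁
  refine ⟨max b₁ 1, max p₁ 3, le_max_left _ _, le_max_left _ _, lt_of_lt_of_le one_pos (le_max_right _ _),
    lt_of_lt_of_le (by norm_num) (le_max_right _ _), fun m hm => ?_⟩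
  have hb₀ : 0 < max b₁ 1 := lt_of_lt_of_le one_pos (le_max_right _ _)
  have hp₀ : 2 < max p₁ 3 := lt_of_lt_of_le (by norm_num) (le_max_right _ _)
  obtain ⟨c₀, C₀, γ₁, hc₀, hγ₁, hγ₁1, hbound⟩ := hS L (max b₁ 1) (max p₁ 3) hb₀ hp₀
  refine ⟨γ₁, hγ₁, fun F γ hFL hγ hγγ₁ => ?_⟩
  have hγ1 : γ ≤ 1 := hγγ₁.trans hγ₁1
  refine historyTailAt_of_perPlaquette F hγ hγ1 hb₀ (by linarith [le_max_right p₁ 3]) hm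
    ⟨Real.exp (9000 * (F.L : ℝ) ^ 3 * |C₀|), 0, c₀, (Real.exp_pos _).le, hc₀, ?_⟩
  exact perPlaquette_of_cappedStiffness F hγ hγ1 hb₀ hc₀ (fun K j hjK => hbound F γ hFL hγ hγγ₁ K j hjK)

end Summit.QuantumFields.YangMills.Theorems.CoarseStiffnessTailHistoryTailOfStiffness

end
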